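import Summits.QuantumFields.BalabanUV.Beta.GAN24.KernelPeriodisationInverse
import Summits.QuantumFields.BalabanUV.Beta.GAN24.ElimPeriodise
import Summits.QuantumFields.BalabanUV.Beta.GAN24.DirichletExhaustionCoer

/-!
# G-an2-4 ∕ (CONV-C), route R7, junction (S)(α) — PART C (THE END): BAŁABAN's TORUS STEP COVARIANCE `C(C*Δ_kC)⁻¹C*` AS TYPED BY pv09 IS THE
# PERIODISATION OF ROAD P2's `ℤ^{d+1}` COVARIANCE `C·(pad(CᵀΔ_kC))_{ℤ^{d+1}}⁻¹·Cᵀ` (the object of `convC_balaban` at `Λ = ℤ^{d+1}`)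

G-an2-4 formalisation swarm `b2b-balaban-gan24-formalise-*`, leaf prover 06 (gen 40), CRUX TEAM (2), ruling «YM REDIRECT» (e34b3e0c; FREEZE (0)
honoured; INTENT «STEP-COVARIANCE-PERIODISE», HOME/CLAIMS.log 2026-08-21 l.34155).  THE ITEM: the pricing desk's CHECK #75 (a) (PRICING-GAN24
v3.16∕v3.17, after this lineage's `StepCovarianceTwoClauses` p291736: «(L3)-Γ_u ✓ at U = 1 (junction S remains)») and ref2 R235-1 («pv09's torus
typing `bondReductionT`, NOT the root's `DirichletExhaustion.ConvC` on ℤ^{d+1}; no `deltaZ ↔ reDelK` junction in the tree») name the junction of the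
two typings of Bałaban's `U = 1` step covariance ([Balaban1984PropagatorsII] (2.156) p. 250 «C^{(k)}_Λ = C(C*Δ_kC)⁻¹C*»):
 (torus, pv09 + this lineage) `(B6Cov2156Torus.bondReductionT L M (reDelK (L^k) _ M)).cov = elimT·(elimTᵀ·Re Δ_k·elimT)⁻¹·elimTᵀ` on the box of
   every unit torus `L ∣ M_i` — `stepCov_two_levels` p291736 (both (CONV-C) clauses, King's rate);
 (ℤ^{d+1}, road P2) `covPad (elimZ L) (deltaZ L) (IsFreeZ L) Λ k = elimZ·(pad(elimZᵀ·Δᶻ_k·elimZ))_Λ⁻¹·elimZᵀ`, `(·)_Λ⁻¹` = pv23's Dirichlet-exhaustion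
   inverse `limInv Λ` — `DirichletExhaustionCoer.convC_balaban` p199806 (both clauses, every `Λ ⊆ ℤ^{d+1}`).
THIS PART proves they are ONE object (0 sorry, 0 def, no cited fact):
 * §1 the inclusion matrix of pv09's remaining variables `ι = 1.submatrix (↑) id` and its bookkeeping with b06's `pad` (`elimT_mul_incl_apply`,
   `incl_mul_pad_mul_incl_transpose : ι * pad F N 1 * ιᵀ = N`, `incl_transpose_mul_mul_incl_apply`);
 * §2 the (5.6) package and the invariances of road P2's padded operator `P_k = pad(elimZᵀ·Δᶻ_k·elimZ)` on `ℤ^{d+1}` (`hyp56_padOp` = the chair's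
   `covInputPad_balaban` + `coer2157Z` through PART 10's `opFamilyRate_innerPad`; `padOp_balaban_sh` from PART B's `elimZ_sh` ∕ `deltaZ_sh`);
 * §3 `per_elimZ_eq : per M (elimZ L) = elimT L M * ι`, `per_trK_elimZ_eq : per M (elimZᵀ) = (elimT L M * ι)ᵀ`, **`per_sandwich_eq : per M (elimZᵀ·Δᶻ_k·elimZ)
   = ιᵀ * (elimTᵀ * Re Δ_k * elimT) * ι`** (PART A `per_comp` twice + PART A2 `sandwich_eq_comp` + PART B), **`per_padOp_eq : per M P_k = pad (freeT L M)
   (elimTᵀ * Re Δ_k * elimT) 1`**, and **`per_limInv_padOp_eq : per M (limInv univ P_k) = pad (freeT L M) (elimTᵀ * Re Δ_k * elimT)⁻¹ 1`** (PART A2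
   `per_limInv_eq_inv` + b06 `pad_inv` + pv09 `sandwich_posDef_reDelK`);
 * §4 THE END **`stepCov_eq_per_covPad : (bondReductionT L M (reDelK (L^k) _ M)).cov = per M (covPad (elimZ L) (deltaZ L) (IsFreeZ L) univ k)`** and its
   entrywise reading **`stepCov_eq_tsum_covPad : C^{(k)}_T(b, b′) = Σ'_{m ∈ ℤ^{d+1}} C^{(k)}_{ℤ^{d+1}}(b̃, b̃′ + M∘m)`** — `1 ≤ d`, `[NeZero L]`, every
   torus `L ∣ M_i`, every `k`, all box bonds.
HONEST SCOPE.  An IDENTIFICATION of two typed objects BY NAME at `U = 1`, with `Λ = ℤ^{d+1}` on the ℤ side (road P2's Dirichlet family `Λ ⊊ ℤ^{d+1}` has no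
torus counterpart and is not touched); it moves NO (CONV-C) clause by itself (both typings already carry both clauses); (β) — the identification with
an1's (MF′) Γ block — waits on S1 and is NOT claimed.  [folklore] real analysis + bond combinatorics (PARTS A, A2, B) over pv09 ∕ pv23 ∕ b06 ∕ road-P2
theorems BY NAME; nothing printed enters as a hypothesis (ABSOLUTE RULE); [Balaban1984PropagatorsII] pp. 249–250 is a TEXT LOCATION.  NOT (CONV-C) as
typed, NEVER «G-an2-4 closed», NOT NE2 ∕ NE3, NOT D1, NOT BetaPertH, NOT continuum, NOT Clay — not in print; our bookkeeping.  HONEST DEPENDENCY: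
continuum YM on T⁴ ⇐ BetaPertH ∧ nine spine estimates (0/9 proved); BetaPertH ⇐ (D1) ∧ (D4) ∧ CAP+tail; G-an2-4 gates asym, D1 and NE2/3/4.
-/

noncomputable section

open scoped BigOperators Matrix
open Finset Real

namespace Summit.QuantumFields.BalabanUV.Beta.GAN24.StepCovariancePeriodise

open Literature.MathematicalPhysics.QuantumFieldTheory.Balaban1983to89
open B4Sect5Proof (cStar deltaStar cStar_pos deltaStar_pos)
open B4Sect5Exhaustion (K Hyp56Z limInv limInv_abs_le)
open B4TorusKernel.MultiPeriod (translate)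
open B6BondElimination (pad pad_mem_mem pad_mem_not pad_not pad_coe pad_inv)
open B6Lemma24Torus (pbox)
open B6Cov2156Torus (freeT elimT bondReductionT bondReductionT_cov gamma2153 gamma2153_pos)
open B6Cov2156TorusDelK (reDelK sandwich_posDef_reDelK)
open Summit.QuantumFields.BalabanUV.Beta.GAN24.DirichletExhaustionSandwich (sandwich sandwichConst abs_sandwich_le)
open Summit.QuantumFields.BalabanUV.Beta.GAN24.DirichletExhaustionCovariance (trK trK_bound)
open Summit.QuantumFields.BalabanUV.Beta.GAN24.DirichletExhaustionCovariancePad (padOp padOp_abs_le covPad opFamilyRate_innerPad)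
open Summit.QuantumFields.BalabanUV.Beta.GAN24.DirichletExhaustionQuadForm (amb)
open Summit.QuantumFields.BalabanUV.Beta.GAN24.DirichletExhaustionDeltaZ (deltaZ c166Z kappaZ kappaZ_pos theta166Z deltaZ_abs_le)
open Summit.QuantumFields.BalabanUV.Beta.GAN24.DirichletExhaustionElimZ (IsFreeZ elimZ elimZ_bound)
open Summit.QuantumFields.BalabanUV.Beta.GAN24.DirichletExhaustionAssembly (covInputPad_balaban theta166Z_nonneg)
open Summit.QuantumFields.BalabanUV.Beta.GAN24.DirichletExhaustionCoer (coer2157Z)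
open Summit.QuantumFields.BalabanUV.Beta.GAN24.KernelPeriodisation (sh sh_eq_sh_iff comp per per_apply per_comp per_trK per_padOp)
open Summit.QuantumFields.BalabanUV.Beta.GAN24.KernelPeriodisationInverse (comp_sh sandwich_sh padOp_sh abs_comp_le sandwich_eq_comp limInv_sh
  per_limInv_eq_inv)
open Summit.QuantumFields.BalabanUV.Beta.GAN24.ElimPeriodise (mem_freeT_iff isFreeZ_sh_iff elimZ_sh deltaZ_sh per_elimZ per_deltaZ_eq_reDelK)

variable {d : ℕ}

/-! ## §1 The inclusion matrix of the remaining variables and b06's padding -/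

section Incl

variable {ι₀ : Type} [DecidableEq ι₀] (F : Finset ι₀)

/-- entries of the inclusion matrix `ι = 1.submatrix (↑) id : Matrix F ι₀ ℝ`. -/
theorem incl_apply (f : F) (q : ι₀) :
    (1 : Matrix ι₀ ι₀ ℝ).submatrix (fun f : F => (f : ι₀)) id f q = if (f : ι₀) = q then 1 else 0 := rfl

/-- entries of its transpose. -/
theorem incl_transpose_apply (q : ι₀) (f : F) :
    ((1 : Matrix ι₀ ι₀ ℝ).submatrix (fun f : F => (f : ι₀)) id)ᵀ q f = if (f : ι₀) = q then 1 else 0 := rfl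

/-- b06's padding with `γ = 1`, entrywise. [folklore] -/
theorem pad_one_apply (N : Matrix F F ℝ) (p q : ι₀) :
    pad F N 1 p q = if h : p ∈ F ∧ q ∈ F then N ⟨p, h.1⟩ ⟨q, h.2⟩ else (if p = q then 1 else 0) := by
  by_cases hp : p ∈ F
  · by_cases hq : q ∈ F
    · rw [pad_mem_mem N 1 hp hq, dif_pos ⟨hp, hq⟩]
    · rw [pad_mem_not N 1 hp hq, dif_neg (fun h => hq h.2), if_neg]
      rintro rfl; exact hq hp
  · rw [pad_not N 1 hp, dif_neg (fun h => hp h.1)]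

/-- the product of a matrix with columns on `F` and the inclusion `ι` is its zero-padding off `F`. [folklore] -/
theorem mul_incl_apply {κ : Type} (E : Matrix κ F ℝ) (p : κ) (q : ι₀) :
    (E * (1 : Matrix ι₀ ι₀ ℝ).submatrix (fun f : F => (f : ι₀)) id) p q = if hq : q ∈ F then E p ⟨q, hq⟩ else 0 := by
  rw [Matrix.mul_apply]
  simp only [incl_apply]
  by_cases hq : q ∈ F
  · rw [dif_pos hq, Finset.sum_eq_single ⟨q, hq⟩]
    · rw [if_pos rfl, mul_one]
    · intro f _ hf
      rw [if_neg (fun h => hf (Subtype.ext h)), mul_zero]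
    · intro h; exact absurd (Finset.mem_univ _) h
  · rw [dif_neg hq]
    refine Finset.sum_eq_zero fun f _ => ?_
    rw [if_neg (fun h : (f : ι₀) = q => hq (h ▸ f.2)), mul_zero]

/-- `(ιᵀ * N * ι) p q = N ⟨p⟩ ⟨q⟩` on `F × F` and `0` elsewhere. [folklore] -/
theorem incl_transpose_mul_mul_incl_apply (N : Matrix F F ℝ) (p q : ι₀) :
    (((1 : Matrix ι₀ ι₀ ℝ).submatrix (fun f : F => (f : ι₀)) id)ᵀ * N * (1 : Matrix ι₀ ι₀ ℝ).submatrix (fun f : F => (f : ι₀)) id) p q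
      = if h : p ∈ F ∧ q ∈ F then N ⟨p, h.1⟩ ⟨q, h.2⟩ else 0 := by
  rw [mul_incl_apply]
  by_cases hq : q ∈ F
  · rw [dif_pos hq, Matrix.mul_apply]
    simp only [incl_transpose_apply]
    by_cases hp : p ∈ F
    · rw [dif_pos ⟨hp, hq⟩, Finset.sum_eq_single ⟨p, hp⟩]
      · rw [if_pos rfl, one_mul]
      · intro f _ hf
        rw [if_neg (fun h => hf (Subtype.ext h)), zero_mul]
      · intro h; exact absurd (Finset.mem_univ _) h
    · rw [dif_neg (fun h => hp h.1)]
      refine Finset.sum_eq_zero fun f _ => ?_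
      rw [if_neg (fun h : (f : ι₀) = p => hp (h ▸ f.2)), zero_mul]
  · rw [dif_neg hq, dif_neg (fun h => hq h.2)]

variable [Fintype ι₀]


/-- `ι * pad F N 1 * ιᵀ = N`: restricting the padded matrix to the kept variables recovers it. [folklore] -/
theorem incl_mul_pad_mul_incl_transpose (N : Matrix F F ℝ) :
    (1 : Matrix ι₀ ι₀ ℝ).submatrix (fun f : F => (f : ι₀)) id * pad F N 1 * ((1 : Matrix ι₀ ι₀ ℝ).submatrix (fun f : F => (f : ι₀)) id)ᵀ = N := by
  ext f g
  rw [Matrix.mul_apply]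
  have h1 : ∀ q, ((1 : Matrix ι₀ ι₀ ℝ).submatrix (fun f : F => (f : ι₀)) id * pad F N 1) f q = pad F N 1 (f : ι₀) q := by
    intro q
    rw [Matrix.mul_apply, Finset.sum_eq_single (f : ι₀)]
    · rw [incl_apply, if_pos rfl, one_mul]
    · intro p _ hp
      rw [incl_apply, if_neg (Ne.symm hp), zero_mul]
    · intro h; exact absurd (Finset.mem_univ _) h
  simp_rw [h1, incl_transpose_apply]
  rw [Finset.sum_eq_single (g : ι₀)]
  · rw [if_pos rfl, mul_one, pad_coe]
  · intro q _ hq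
    rw [if_neg (Ne.symm hq), mul_zero]
  · intro h; exact absurd (Finset.mem_univ _) h

end Incl

/-! ## §2 Road P2's padded operator `P_k = pad(elimZᵀ·Δᶻ_k·elimZ)` on `ℤ^{d+1}`: (5.6) package and invariance -/

section Operator

variable (L : ℕ) [NeZero L] (M : Fin (d + 1) → ℕ) [∀ μ, NeZero (M μ)]

omit [∀ μ, NeZero (M μ)] in
/-- **(5.6) on all of `ℤ^{d+1}` for `P_k`** (`d ≥ 1`): the chair's `covInputPad_balaban` fed with `coer2157Z` (road P2 PART 18), through PART 10's
`opFamilyRate_innerPad`; constants `(gamma2153 (d+1) L, max{s·c166Z, 1}, κZ/2)`, `s = sandwichConst (d+1) (d+1) e^{κZ(L−1)} κZ`. -/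
theorem hyp56_padOp (hd : 1 ≤ d) (k : ℕ) :
    Hyp56Z (Set.univ : Set (Fin (d + 1) → ℤ)) (padOp (IsFreeZ L) (sandwich (elimZ L) (deltaZ L k))) (gamma2153 (d + 1) L)
      (max (sandwichConst (d + 1) (d + 1) (Real.exp (kappaZ d * ((L : ℝ) - 1))) (kappaZ d) * c166Z d) 1) (kappaZ d / 2) :=
  (opFamilyRate_innerPad (covInputPad_balaban L (coer2157Z hd L)) (kappaZ_pos d) (Real.exp_pos _).le (theta166Z_nonneg d)
    (by positivity)).hyp56 k

omit [∀ μ, NeZero (M μ)] in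
/-- `elimZᵀ` is invariant under the period lattice (`L ∣ M_i`). -/
theorem trK_elimZ_sh (hLM : ∀ i, L ∣ M i) (m : Fin (d + 1) → ℤ) (p q : K (d + 1) (d + 1)) :
    trK (elimZ L) (sh M m p) (sh M m q) = trK (elimZ L) p q := by
  unfold trK
  exact elimZ_sh (Nat.pos_of_ne_zero (NeZero.ne L)) hLM m q p

/-- **`P_k` is invariant under the period lattice** (`L ∣ M_i`; PART B's `elimZ_sh`, `deltaZ_sh`, `isFreeZ_sh_iff`, PART A2's `sandwich_sh`, `padOp_sh`). -/
theorem padOp_balaban_sh (hLM : ∀ i, L ∣ M i) (k : ℕ) (m : Fin (d + 1) → ℤ) (p q : K (d + 1) (d + 1)) :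
    padOp (IsFreeZ L) (sandwich (elimZ L) (deltaZ L k)) (sh M m p) (sh M m q) = padOp (IsFreeZ L) (sandwich (elimZ L) (deltaZ L k)) p q :=
  padOp_sh M (isFreeZ_sh_iff (Nat.pos_of_ne_zero (NeZero.ne L)) hLM) (sandwich_sh M (elimZ_sh (Nat.pos_of_ne_zero (NeZero.ne L)) hLM)
    (deltaZ_sh k)) m p q

end Operator

/-! ## §3 The periodisations of road P2's objects are pv09's torus matrices -/

section Periodise

variable (L : ℕ) [NeZero L] (M : Fin (d + 1) → ℕ) [∀ μ, NeZero (M μ)]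

local notation "ιT" => Matrix.submatrix (1 : Matrix (B4.Idx (pbox M) (d + 1)) (B4.Idx (pbox M) (d + 1)) ℝ)
  (fun f : ↥(freeT L M) => (f : B4.Idx (pbox M) (d + 1))) id

/-- **`per M (elimZ L) = elimT L M * ι`** (PART B's `per_elimZ`). -/
theorem per_elimZ_eq (hLM : ∀ i, L ∣ M i) : per M (elimZ L) = elimT L M * ιT := by
  ext p q
  rw [per_elimZ M hLM, mul_incl_apply]

/-- **`per M (elimZᵀ) = (elimT L M * ι)ᵀ`** (PART A's `per_trK` for the invariant `elimZ`). -/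
theorem per_trK_elimZ_eq (hLM : ∀ i, L ∣ M i) : per M (trK (elimZ L)) = (elimT L M * ιT)ᵀ := by
  ext p q
  rw [per_trK M (elimZ_sh (Nat.pos_of_ne_zero (NeZero.ne L)) hLM), Matrix.transpose_apply, ← per_elimZ_eq L M hLM]

/-- **`per M (elimZᵀ·Δᶻ_k·elimZ) = ιᵀ * (elimTᵀ * Re Δ_k * elimT) * ι`**: road P2's pair-sum sandwich as the iterated composition (PART A2), PART A's
`per_comp` twice (the inner factors `Δᶻ_k ∘ elimZ` and `elimZ` are invariant and exponentially bounded), PART B's `per_elimZ` ∕ `per_deltaZ_eq_reDelK`. -/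
theorem per_sandwich_eq (hLM : ∀ i, L ∣ M i) (k : ℕ) (h : 1 ≤ L ^ k) :
    per M (sandwich (elimZ L) (deltaZ L k)) = (ιT)ᵀ * ((elimT L M)ᵀ * reDelK (L ^ k) h M * elimT L M) * ιT := by
  have hL : 0 < L := Nat.pos_of_ne_zero (NeZero.ne L)
  have hκ : 0 < kappaZ d := kappaZ_pos d
  set cC : ℝ := Real.exp (kappaZ d * ((L : ℝ) - 1)) with hcC
  have hcC0 : 0 ≤ cC := (Real.exp_pos _).le
  have hC : ∀ r p : K (d + 1) (d + 1), |elimZ L r p| ≤ cC * Real.exp (-(kappaZ d * dist r.1 p.1)) := fun r p => elimZ_bound hL hκ.le r p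
  have hCt : ∀ r p : K (d + 1) (d + 1), |trK (elimZ L) r p| ≤ cC * Real.exp (-(kappaZ d * dist r.1 p.1)) := trK_bound hC
  have hΔ : ∀ r s : K (d + 1) (d + 1), |deltaZ L k r s| ≤ c166Z d * Real.exp (-(kappaZ d * dist r.1 s.1)) := deltaZ_abs_le L k
  have hc166 : 0 ≤ c166Z d := by
    have h0 := hΔ ((0 : Fin (d + 1) → ℤ), 0) ((0 : Fin (d + 1) → ℤ), 0)
    rw [dist_self, mul_zero, neg_zero, Real.exp_zero, mul_one] at h0
    exact (abs_nonneg _).trans h0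
  -- the pair-sum is the iterated composition
  have hsw : sandwich (elimZ (d := d) L) (deltaZ L k) = comp (trK (elimZ L)) (comp (deltaZ L k) (elimZ L)) := by
    funext p q
    exact sandwich_eq_comp hκ hcC0 hC hΔ p q
  -- the inner composition is invariant and exponentially bounded
  have hinner_sh : ∀ m p q, comp (deltaZ L k) (elimZ L) (sh M m p) (sh M m q) = comp (deltaZ L k) (elimZ L) p q :=
    comp_sh M (deltaZ_sh k) (elimZ_sh hL hLM)
  have hinner : ∀ p q : K (d + 1) (d + 1), |comp (deltaZ L k) (elimZ L) p q|
      ≤ c166Z d * cC * ((d + 1 : ℕ) * B4Sect5Proof.latticeConst (d + 1) (kappaZ d / 2)) * Real.exp (-(kappaZ d / 2 * dist p.1 q.1)) :=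
    abs_comp_le hκ hc166 hΔ hC
  have hK0 : 0 ≤ c166Z d * cC * ((d + 1 : ℕ) * B4Sect5Proof.latticeConst (d + 1) (kappaZ d / 2)) :=
    mul_nonneg (mul_nonneg hc166 hcC0) (mul_nonneg (Nat.cast_nonneg _) (B4Sect5Proof.latticeConst_nonneg _ (half_pos hκ).le))
  rw [hsw, per_comp M (half_pos hκ) (half_pos hκ) hcC0 hK0
      (fun r p => (hCt r p).trans (mul_le_mul_of_nonneg_left (Real.exp_le_exp.mpr (by nlinarith [dist_nonneg (x := r.1) (y := p.1)])) hcC0))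
      hinner hinner_sh,
    per_comp M hκ hκ hc166 hcC0 hΔ hC (elimZ_sh hL hLM), per_trK_elimZ_eq L M hLM, per_elimZ_eq L M hLM, per_deltaZ_eq_reDelK M k h,
    Matrix.transpose_mul]
  simp only [Matrix.mul_assoc]

/-- **`per M P_k = pad (freeT L M) (elimTᵀ * Re Δ_k * elimT) 1`** — the periodisation of road P2's padded operator is b06's padding of pv09's reduced
quadratic form `C*Δ_kC` on the remaining variables of the torus (PART A's `per_padOp`, PART B's `mem_freeT_iff`, §1). -/
theorem per_padOp_eq (hLM : ∀ i, L ∣ M i) (k : ℕ) (h : 1 ≤ L ^ k) :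
    per M (padOp (IsFreeZ L) (sandwich (elimZ L) (deltaZ L k))) = pad (freeT L M) ((elimT L M)ᵀ * reDelK (L ^ k) h M * elimT L M) 1 := by
  have hL : 0 < L := Nat.pos_of_ne_zero (NeZero.ne L)
  ext p q
  rw [per_padOp M (isFreeZ_sh_iff hL hLM), per_sandwich_eq L M hLM k h, incl_transpose_mul_mul_incl_apply, pad_one_apply]
  by_cases hpq : p ∈ freeT L M ∧ q ∈ freeT L M
  · have hZ : IsFreeZ L (amb p) ∧ IsFreeZ L (amb q) := ⟨(mem_freeT_iff M hL p).1 hpq.1, (mem_freeT_iff M hL q).1 hpq.2⟩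
    rw [if_pos hZ, dif_pos hpq, dif_pos hpq]
  · have hZ : ¬ (IsFreeZ L (amb p) ∧ IsFreeZ L (amb q)) := fun h' =>
      hpq ⟨(mem_freeT_iff M hL p).2 h'.1, (mem_freeT_iff M hL q).2 h'.2⟩
    rw [if_neg hZ, dif_neg hpq]

/-- pv09's reduced quadratic form on the remaining variables is invertible (`sandwich_posDef_reDelK`: `d + 1 ≥ 2`, `L ≥ 1`, `L ∣ M_i`). -/
theorem isUnit_det_sandwichT (hd : 1 ≤ d) (hLM : ∀ i, L ∣ M i) (k : ℕ) (h : 1 ≤ L ^ k) :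
    IsUnit ((elimT L M)ᵀ * reDelK (L ^ k) h M * elimT L M).det :=
  (Matrix.isUnit_iff_isUnit_det _).1
    (sandwich_posDef_reDelK (d := d + 1) (by omega) (Nat.one_le_iff_ne_zero.mpr (NeZero.ne L)) hLM (L ^ k) h).isUnit

/-- **`per M (limInv univ P_k) = pad (freeT L M) (elimTᵀ * Re Δ_k * elimT)⁻¹ 1`** — the periodisation of pv23's infinite-volume inverse of road P2's
padded operator is the padded torus inverse (PART A2's `per_limInv_eq_inv` on §2's (5.6) package and invariance; b06's `pad_inv`). -/
theorem per_limInv_padOp_eq (hd : 1 ≤ d) (hLM : ∀ i, L ∣ M i) (k : ℕ) (h : 1 ≤ L ^ k) :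
    per M (limInv Set.univ (padOp (IsFreeZ L) (sandwich (elimZ L) (deltaZ L k))))
      = pad (freeT L M) ((elimT L M)ᵀ * reDelK (L ^ k) h M * elimT L M)⁻¹ 1 := by
  have hL1 : 1 ≤ L := Nat.one_le_iff_ne_zero.mpr (NeZero.ne L)
  rw [per_limInv_eq_inv M (gamma2153_pos (d := d + 1) (by omega) hL1) (lt_max_of_lt_right one_pos) (half_pos (kappaZ_pos d))
      (hyp56_padOp L hd k) (padOp_balaban_sh L M hLM k), per_padOp_eq L M hLM k h,
    pad_inv _ (isUnit_det_sandwichT L M hd hLM k h) one_ne_zero, inv_one]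

/-! ## §4 THE END: the torus step covariance is the periodisation of the `ℤ^{d+1}` covariance -/

/-- **`stepCov_eq_per_covPad` — BAŁABAN's TORUS STEP COVARIANCE IS THE PERIODISATION OF ROAD P2's `ℤ^{d+1}` COVARIANCE** (`1 ≤ d`, `[NeZero L]`, every
torus `M` with `L ∣ M_i`, every `k`): `(bondReductionT L M (reDelK (L^k) _ M)).cov = per M (covPad (elimZ L) (deltaZ L) (IsFreeZ L) univ k)`, i.e.
pv09's `C(C*Δ_kC)⁻¹C*` on the box ([B6] (2.156), the explicit axial-gauge `C = elimT` of p. 250, the genuine (1.65) `Δ_k`) is the matrix of periodised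
entries of road P2's `elimZ·(pad(elimZᵀ·Δᶻ_k·elimZ))_{ℤ^{d+1}}⁻¹·elimZᵀ` (pv23's exhaustion inverse at `Λ = ℤ^{d+1}`).  Chain: `covPad = elimZ ∘ (X ∘ elimZᵀ)`
(PART A2 `sandwich_eq_comp`), `per_comp` twice (PART A), `per X = pad (C*Δ_kC)⁻¹ 1` (§3), `per elimZ = elimT·ι` (PART B), `ι·pad N 1·ιᵀ = N` (§1).
[cite: Balaban1984PropagatorsII, (2.152)–(2.157) pp.249–250] [folklore] -/
theorem stepCov_eq_per_covPad (hd : 1 ≤ d) (hLM : ∀ i, L ∣ M i) (k : ℕ) (h : 1 ≤ L ^ k) :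
    (bondReductionT L M (reDelK (L ^ k) h M)).cov = per M (covPad (elimZ L) (deltaZ L) (IsFreeZ L) Set.univ k) := by
  have hL : 0 < L := Nat.pos_of_ne_zero (NeZero.ne L)
  have hL1 : 1 ≤ L := hL
  have hγ : 0 < gamma2153 (d + 1) L := gamma2153_pos (d := d + 1) (by omega) hL1
  have hc : (0 : ℝ) < max (sandwichConst (d + 1) (d + 1) (Real.exp (kappaZ d * ((L : ℝ) - 1))) (kappaZ d) * c166Z d) 1 :=
    lt_max_of_lt_right one_pos
  have hδ : 0 < kappaZ d / 2 := half_pos (kappaZ_pos d)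
  have hP := hyp56_padOp L hd k
  -- pv23's inverse kernel `X`: decay `(cStar, deltaStar)` and invariance
  set δX : ℝ := deltaStar (d + 1) (d + 1) (gamma2153 (d + 1) L)
    (max (sandwichConst (d + 1) (d + 1) (Real.exp (kappaZ d * ((L : ℝ) - 1))) (kappaZ d) * c166Z d) 1) (kappaZ d / 2) with hδX
  set cX : ℝ := cStar (d + 1) (d + 1) (gamma2153 (d + 1) L)
    (max (sandwichConst (d + 1) (d + 1) (Real.exp (kappaZ d * ((L : ℝ) - 1))) (kappaZ d) * c166Z d) 1) (kappaZ d / 2) with hcX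
  have hδX0 : 0 < δX := deltaStar_pos (d + 1) (d + 1) hγ hc.le hδ
  have hcX0 : 0 ≤ cX := (cStar_pos (d + 1) (d + 1) _ _ hγ).le
  have hX : ∀ p q : K (d + 1) (d + 1), |limInv Set.univ (padOp (IsFreeZ L) (sandwich (elimZ L) (deltaZ L k))) p q|
      ≤ cX * Real.exp (-(δX * dist p.1 q.1)) := limInv_abs_le hγ hc hδ hP
  have hXsh := limInv_sh M hγ hc hδ hP (padOp_balaban_sh L M hLM k)
  -- road P2's elimination at the rate of `X`
  set cC : ℝ := Real.exp (δX * ((L : ℝ) - 1)) with hcC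
  have hcC0 : 0 ≤ cC := (Real.exp_pos _).le
  have hC : ∀ r p : K (d + 1) (d + 1), |elimZ L r p| ≤ cC * Real.exp (-(δX * dist r.1 p.1)) := fun r p => elimZ_bound hL hδX0.le r p
  have hCt : ∀ r p : K (d + 1) (d + 1), |trK (elimZ L) r p| ≤ cC * Real.exp (-(δX * dist r.1 p.1)) := trK_bound hC
  have hCsh := elimZ_sh (M := M) hL hLM
  have hCtsh := trK_elimZ_sh L M hLM
  -- `covPad = elimZ ∘ (X ∘ elimZᵀ)`
  have hcov : covPad (elimZ (d := d) L) (deltaZ L) (IsFreeZ L) Set.univ k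
      = comp (elimZ L) (comp (limInv Set.univ (padOp (IsFreeZ L) (sandwich (elimZ L) (deltaZ L k)))) (trK (elimZ L))) := by
    funext p q
    exact sandwich_eq_comp hδX0 hcC0 hCt hX p q
  have hinner_sh : ∀ m p q, comp (limInv Set.univ (padOp (IsFreeZ L) (sandwich (elimZ L) (deltaZ L k)))) (trK (elimZ L)) (sh M m p) (sh M m q)
      = comp (limInv Set.univ (padOp (IsFreeZ L) (sandwich (elimZ L) (deltaZ L k)))) (trK (elimZ L)) p q :=
    comp_sh M hXsh hCtsh
  have hinner : ∀ p q : K (d + 1) (d + 1),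
      |comp (limInv Set.univ (padOp (IsFreeZ L) (sandwich (elimZ L) (deltaZ L k)))) (trK (elimZ L)) p q|
        ≤ cX * cC * ((d + 1 : ℕ) * B4Sect5Proof.latticeConst (d + 1) (δX / 2)) * Real.exp (-(δX / 2 * dist p.1 q.1)) :=
    abs_comp_le hδX0 hcX0 hX hCt
  have hK0 : 0 ≤ cX * cC * ((d + 1 : ℕ) * B4Sect5Proof.latticeConst (d + 1) (δX / 2)) :=
    mul_nonneg (mul_nonneg hcX0 hcC0) (mul_nonneg (Nat.cast_nonneg _) (B4Sect5Proof.latticeConst_nonneg _ (half_pos hδX0).le))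
  rw [hcov, per_comp M (half_pos hδX0) (half_pos hδX0) hcC0 hK0
      (fun r p => (hC r p).trans (mul_le_mul_of_nonneg_left (Real.exp_le_exp.mpr (by nlinarith [dist_nonneg (x := r.1) (y := p.1)])) hcC0))
      hinner hinner_sh,
    per_comp M hδX0 hδX0 hcX0 hcC0 hX hCt hCtsh, per_limInv_padOp_eq L M hd hLM k h, per_elimZ_eq L M hLM, per_trK_elimZ_eq L M hLM,
    bondReductionT_cov, Matrix.transpose_mul]
  -- `elimT·(C*Δ_kC)⁻¹·elimTᵀ = elimT·(ι·pad (C*Δ_kC)⁻¹ 1·ιᵀ)·elimTᵀ = elimT·ι·(pad (C*Δ_kC)⁻¹ 1·(ιᵀ·elimTᵀ))`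
  conv_lhs => rw [← incl_mul_pad_mul_incl_transpose (freeT L M) ((elimT L M)ᵀ * reDelK (L ^ k) h M * elimT L M)⁻¹]
  simp only [Matrix.mul_assoc]

/-- **`stepCov_eq_tsum_covPad` — THE JUNCTION (S)(α), ENTRYWISE**: on every unit torus `L ∣ M_i` (`1 ≤ d`, `[NeZero L]`), for every `k` and all box
bonds `b = (x, α)`, `b′ = (y, β)`:  `C^{(k)}_T(b, b′) = Σ'_{m ∈ ℤ^{d+1}} C^{(k)}_{ℤ^{d+1}}((x, α), (y + M∘m, β))` — pv09's torus step covariance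
(`bondReductionT … (reDelK (L^k) _ M)).cov`, the object of this lineage's `stepCov_two_levels` p291736) is the periodisation of road P2's `ℤ^{d+1}`
covariance `covPad (elimZ L) (deltaZ L) (IsFreeZ L) univ k` (the object of the chair's `convC_balaban` p199806 at `Λ = ℤ^{d+1}`).
[cite: Balaban1984PropagatorsII, (2.156) p.250] [folklore] -/
theorem stepCov_eq_tsum_covPad (hd : 1 ≤ d) (hLM : ∀ i, L ∣ M i) (k : ℕ) (h : 1 ≤ L ^ k) (p q : B4.Idx (pbox M) (d + 1)) :
    (bondReductionT L M (reDelK (L ^ k) h M)).cov p q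
      = ∑' m : Fin (d + 1) → ℤ, covPad (elimZ L) (deltaZ L) (IsFreeZ L) Set.univ k ((p.1 : Fin (d + 1) → ℤ), p.2)
          (translate M (q.1 : Fin (d + 1) → ℤ) m, q.2) := by
  rw [stepCov_eq_per_covPad L M hd hLM k h]
  rfl

end Periodise

end Summit.QuantumFields.BalabanUV.Beta.GAN24.StepCovariancePeriodise

end
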